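import Summits.KontsevichZagierPeriods.KontsevichZagierPeriods.Theses.FermatIsogeny
import Summits.KontsevichZagierPeriods.KontsevichZagierPeriods.Theorems.FermatIsogenyBetaLinearSectorSectorAssembly
import Summits.KontsevichZagierPeriods.KontsevichZagierPeriods.Theorems.FermatIsogenyBetaLinearSectorSixthsRung
import Summits.KontsevichZagierPeriods.KontsevichZagierPeriods.Theorems.FermatIsogenyBetaLinearSectorSixthsNormalFormUpper
import Summits.KontsevichZagierPeriods.KontsevichZagierPeriods.Theorems.FermatIsogenyBetaLinearSectorSixthsStubIsoSecondKindArcs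
import Summits.KontsevichZagierPeriods.KontsevichZagierPeriods.Theorems.FermatIsogenyBetaLinearSectorSixthsStubIsoSecondKindTail
import Summits.KontsevichZagierPeriods.KontsevichZagierPeriods.Theorems.FermatIsogenyBetaLinearSectorSixthsStubLink43Tail
import Summits.KontsevichZagierPeriods.KontsevichZagierPeriods.Theorems.FermatIsogenyBetaLinearSectorSixthsStubLink45Tail
import Summits.KontsevichZagierPeriods.KontsevichZagierPeriods.Theorems.FermatIsogenyBetaLinearSectorSixthsStubLink25To45
import Summits.KontsevichZagierPeriods.KontsevichZagierPeriods.Theorems.FermatIsogenyBetaLinearSectorIntegerSums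

/-!
# `BetaLinearSector` at LEVEL `6` UNCONDITIONALLY, and on the MAXIMAL `(π, Γ(1/3))`-SECTOR: sixth-integral ∪ integral sum ∪ rational class

Crux `BetaLinearSector` (stmt-KontsevichZagierPeriods-3897, route FermatIsogeny): two one-dimensional Kontsevich–Zagier representations pinned on
`(0,1)` as `[t^{a-1}(1-t)^{b-1}]` and `[c·t^{a'-1}(1-t)^{b'-1}]` with the same value are KZ-equivalent.  This file CLOSES THE LEVEL-6 RUNG and
the maximal sector of the `(π, Γ(1/3))` world:

* `upperNF_holds` — the normal form of the ten upper level-6 cells (class `π²/Γ(1/3)³`, the second-kind periods of the CM curves `y² = x³ ± 1`)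
  is now UNCONDITIONAL: the landed links `stub_link43_tail_of_iso` (`β(2/3,1/2) ∼ [2√3/(X²√(X³−1)) on (1,∞)]`, exact correction
  `d(6x²y/(x³+4))` on the arc `(−1,0)` + the second-kind 3-isogeny pull-back), `stub_link45_tail_of_iso` (`β(2/3,5/6) ∼ [4/(√3X²√(X³−1))]`,
  `t = x³/(1+x³)`, exact correction `d(−6x²/((x³+4)y))`, the pull-backs on `(0,2)` and `(2,∞)`), `stub_link25_45`
  (`β(1/3,5/6) ∼ (3/2)2^{1/3}β(2/3,5/6)`: `t = 1 − s⁶`, exact correction `d(−6s⁵(1−s⁶)^{1/3}/(1+s⁶))`, ONE rational move `t = ((1−s⁶)/(1+s⁶))²`)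
  fed into `normalForm_sixths_upper_of_links`, with the second-kind isogeny moves `isoSK_neg_equivalent`, `isoSK_mid_equivalent`,
  `stub_isoThree_secondKind_tail`;
* `betaLinearSector_sixths` — **the level-6 rung** (`a, b, a', b' ∈ ⅙ℤ`), from `betaLinearSector_sixths_of_normalForm_upper`: Beta values in
  `ℚ̄·{1, π, Γ(1/3)³/π, π²/Γ(1/3)³}`, transcendence input Chudnovsky's `(π, Γ(1/3))` (PROVED in the tree);
* `betaLinearSector_sixthsMax` — **the maximal `(π, Γ(1/3))`-sector**: each pair sixth-integral, OR of integral sum (Euler sector, any level), OR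
  with an integral exponent (rational class, any level), via the generic assembly `Assembly.betaLinearSector_of_oracle` and the normal-form oracle
  (`rung6_normalForm upperNF_holds` + Euler cells through `[π]` + rational cells through the point).  Any pair beyond this sector and its
  `(π, Γ(1/4))` twin (`QuartersMax`) needs Wolfart–Wüstholz / Huber–Wüstholz — the apex of the line.

References: M. Kontsevich, D. Zagier, *Periods* (2001), §1.2; G. V. Chudnovsky (1984), Ch. 7 §2 Cor. 2.3; N. Koblitz, D. Rohrlich, Canad. J. Math.
30 (1978); B. Gross (with an appendix by D. Rohrlich), Invent. Math. 45 (1978).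
-/

noncomputable section

namespace Summit.KontsevichZagierPeriods.FermatIsogeny.BetaLinearSector.SixthsMax

open MeasureTheory Set
open Literature.NumberTheory.Transcendental
open Literature.NumberTheory.Transcendental.KZ
open Summit.KontsevichZagierPeriods.FermatIsogeny.BetaLinearSector.HalfIntegers
open Summit.KontsevichZagierPeriods.FermatIsogeny.BetaLinearSector.Assembly (betaLinearSector_of_oracle)
open Summit.KontsevichZagierPeriods.FermatIsogeny.BetaLinearSector.Sixths
open Summit.KontsevichZagierPeriods.FermatIsogeny.BetaLinearSector.Thirds (nf_a_one v_pos v_sep)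
open Summit.KontsevichZagierPeriods.FermatIsogeny.BetaLinearSector.IntegerSums (base_cases nf_reflection)
open Summit.KontsevichZagierPeriods.KontsevichZagierPeriods.BetaCancellationLine (sin_pi_mul_pos)
open Summit.KontsevichZagierPeriods.KontsevichZagierPeriods.BetaCancellationNegative (isAlgebraic_sin_pi_mul_rat)

set_option quotPrecheck false in
/-- `r` is PINNED as `[(0,1), c · t^{a-1}(1-t)^{b-1}]`. -/
local notation "Pinned⟦" c ", " a ", " b ", " r "⟧" =>
  (IntegralRep.domain r = {x : Fin 1 → ℝ | x 0 ∈ Set.Ioo (0:ℝ) 1} ∧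
    Set.EqOn (IntegralRep.integrand r) (fun x : Fin 1 → ℝ => (c : ℝ) * (x 0) ^ (((a : ℚ) : ℝ) - 1) * (1 - x 0) ^ (((b : ℚ) : ℝ) - 1))
      (IntegralRep.domain r))

set_option quotPrecheck false in
/-- The MAXIMAL `(π, Γ(1/3))`-SECTOR predicate on a pair: sixth-integral, or of integral sum, or one exponent integral. -/
local notation "Sec⟦" a ", " b "⟧" =>
  (((∃ m : ℤ, (a : ℚ) = m / 6) ∧ (∃ m : ℤ, (b : ℚ) = m / 6)) ∨ (∃ m : ℤ, (a : ℚ) + b = m) ∨ (∃ m : ℤ, (a : ℚ) = m) ∨ (∃ m : ℤ, (b : ℚ) = m))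

set_option quotPrecheck false in
/-- The BASE-CELL classes of the sector: sixth cell, Euler cell `(a, 1−a)`, or rational cell `(1, b)` / `(a, 1)`. -/
local notation "Cell⟦" a ", " b "⟧" =>
  ((0 : ℚ) < a ∧ (0 : ℚ) < b ∧
    (((a = 1 / 6 ∨ a = 1 / 3 ∨ a = 1 / 2 ∨ a = 2 / 3 ∨ a = 5 / 6 ∨ a = 1) ∧ (b = 1 / 6 ∨ b = 1 / 3 ∨ b = 1 / 2 ∨ b = 2 / 3 ∨ b = 5 / 6 ∨ b = 1)) ∨
    (a < 1 ∧ b = 1 - a) ∨ a = 1 ∨ b = 1))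

set_option quotPrecheck false in
/-- The four CLASS VALUES `(1, π, Γ(1/3)³/π, π²/Γ(1/3)³)` of the level-`3` file. -/
local notation "v" => (![1, Real.pi, Real.Gamma (1/3) ^ 3 / Real.pi, Real.pi ^ 2 / Real.Gamma (1/3) ^ 3] : Fin 4 → ℝ)

set_option quotPrecheck false in
/-- The ALGEBRAIC FACTORS `(1, 1, √3/2^{4/3}, 2^{7/3})` of the values of the canonical cells relative to `v` (level-6 rung file). -/
local notation "κ" => (![1, 1, Real.sqrt 3 / (2 * (2:ℝ) ^ (1/3:ℝ)), 4 * (2:ℝ) ^ (1/3:ℝ)] : Fin 4 → ℝ)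

/-! ## The level-6 rung, unconditionally -/

/-- **THE NORMAL FORM OF THE TEN UPPER LEVEL-6 CELLS IS UNCONDITIONAL**: the three links and the second-kind 3-isogeny moves are landed theorems.
[cite: KontsevichZagier2001, §1.2] -/
theorem upperNF_holds : ∀ (c : ℝ), IsAlgebraic ℚ c → ∀ (a b : ℚ),
    (a = 1 / 3 ∨ a = 1 / 2 ∨ a = 2 / 3 ∨ a = 5 / 6) → (b = 1 / 3 ∨ b = 1 / 2 ∨ b = 2 / 3 ∨ b = 5 / 6) → 1 < a + b →
    ∀ (r T : KZ.IntegralRep 1),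
    (r.domain = {x | x 0 ∈ Set.Ioo (0:ℝ) 1} ∧
      Set.EqOn r.integrand (fun x => c * (x 0) ^ ((a:ℝ) - 1) * (1 - x 0) ^ ((b:ℝ) - 1)) r.domain) →
    (T.domain = {x | x 0 ∈ Set.Ioo (0:ℝ) 1} ∧
      Set.EqOn T.integrand (fun x => (1:ℝ) * (x 0) ^ (((2/3:ℚ):ℝ) - 1) * (1 - x 0) ^ (((1/2:ℚ):ℝ) - 1)) T.domain) →
    ∃ (q : ℝ) (hk : IsAlgebraic ℚ (c * q)), 0 < q ∧ KZ.Equivalent r (T.constMul (c * q) hk) :=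
  normalForm_sixths_upper_of_links
    (stub_link43_tail_of_iso fun S T hSd hSi hTd hTi => isoSK_neg_equivalent S T hSd hSi hTd hTi)
    (stub_link45_tail_of_iso (fun S T hSd hSi hTd hTi => isoSK_mid_equivalent S T hSd hSi hTd hTi) stub_isoThree_secondKind_tail)
    stub_link25_45

/-- **`BetaLinearSector` ON THE SIXTH-INTEGER SECTOR, UNCONDITIONALLY** (registered anchor `betaLinearSector_sixths`): Conjecture 1 of Kontsevich–Zagier
for every pair of Beta integrals with `a, b, a', b' ∈ ⅙ℕ_{>0}` — the level of the CM curves `y² = x³ ± 1`, with the Koblitz–Rohrlich coincidences of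
the sextic Fermat curve realised inside the rules (Legendre duplication, the CM `3`-isogeny on first- AND second-kind forms, the twist `y² = x³ + 4`),
transcendence input Chudnovsky's `(π, Γ(1/3))`. [cite: KontsevichZagier2001, §1.2] [cite: Chudnovsky1984, Ch. 7 §2 Cor. 2.3] -/
theorem betaLinearSector_sixths : ∀ (a b a' b' : ℚ) (c : ℝ), 0 < a → 0 < b → 0 < a' → 0 < b' → IsAlgebraic ℚ c →
    (∃ m : ℤ, a = m / 6) → (∃ m : ℤ, b = m / 6) → (∃ m : ℤ, a' = m / 6) → (∃ m : ℤ, b' = m / 6) →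
    ∀ (r r' : KZ.IntegralRep 1), r.domain = {x | x 0 ∈ Set.Ioo (0:ℝ) 1} →
    Set.EqOn r.integrand (fun x => (x 0) ^ ((a:ℝ) - 1) * (1 - x 0) ^ ((b:ℝ) - 1)) r.domain →
    r'.domain = {x | x 0 ∈ Set.Ioo (0:ℝ) 1} →
    Set.EqOn r'.integrand (fun x => c * (x 0) ^ ((a':ℝ) - 1) * (1 - x 0) ^ ((b':ℝ) - 1)) r'.domain →
    r.value = r'.value → KZ.Equivalent r r' :=
  betaLinearSector_sixths_of_normalForm_upper upperNF_holds

/-! ## The maximal `(π, Γ(1/3))`-sector -/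

/-- The LEVEL-`N` sector predicate (`N`-integral, or of integral sum, or one exponent integral) survives lowering the second exponent by one.
[folklore] -/
theorem secN_sub_right (N : ℕ) (a b : ℚ)
    (h : ((∃ m : ℤ, a = m / N) ∧ (∃ m : ℤ, b = m / N)) ∨ (∃ m : ℤ, a + b = m) ∨ (∃ m : ℤ, a = m) ∨ (∃ m : ℤ, b = m)) :
    ((∃ m : ℤ, a = m / N) ∧ (∃ m : ℤ, b - 1 = m / N)) ∨ (∃ m : ℤ, a + (b - 1) = m) ∨ (∃ m : ℤ, a = m) ∨ (∃ m : ℤ, b - 1 = m) := by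
  rcases h with ⟨hma, ⟨m, hm⟩⟩ | ⟨m, hm⟩ | ⟨m, hm⟩ | ⟨m, hm⟩
  · by_cases hN : (N : ℚ) = 0
    · refine Or.inr (Or.inr (Or.inr ⟨-1, ?_⟩))
      rw [hm, hN, div_zero]
      norm_num
    · exact Or.inl ⟨hma, ⟨m - N, by rw [hm]; field_simp; push_cast; ring⟩⟩
  · exact Or.inr (Or.inl ⟨m - 1, by push_cast; linarith⟩)
  · exact Or.inr (Or.inr (Or.inl ⟨m, hm⟩))
  · exact Or.inr (Or.inr (Or.inr ⟨m - 1, by rw [hm]; push_cast; ring⟩))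

/-- The LEVEL-`N` sector predicate survives the swap followed by lowering. [folklore] -/
theorem secN_swap_sub (N : ℕ) (a b : ℚ)
    (h : ((∃ m : ℤ, a = m / N) ∧ (∃ m : ℤ, b = m / N)) ∨ (∃ m : ℤ, a + b = m) ∨ (∃ m : ℤ, a = m) ∨ (∃ m : ℤ, b = m)) :
    ((∃ m : ℤ, b = m / N) ∧ (∃ m : ℤ, a - 1 = m / N)) ∨ (∃ m : ℤ, b + (a - 1) = m) ∨ (∃ m : ℤ, b = m) ∨ (∃ m : ℤ, a - 1 = m) := by
  refine secN_sub_right N b a ?_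
  rcases h with ⟨hma, hmb⟩ | ⟨m, hm⟩ | hm | hm
  · exact Or.inl ⟨hmb, hma⟩
  · exact Or.inr (Or.inl ⟨m, by rw [← hm]; ring⟩)
  · exact Or.inr (Or.inr (Or.inr hm))
  · exact Or.inr (Or.inr (Or.inl hm))

/-- **NORMAL-FORM ORACLE of the maximal `(π, Γ(1/3))`-sector**: every base cell normalises onto a non-zero algebraic multiple of one of the four
canonical cells `T₀ = [β(1,1)]`, `T₁ = [β(1/2,1/2)]`, `T₂ = [β(1/3,1/2)]`, `T₃ = [β(2/3,1/2)]` — sixth cells by `rung6_normalForm upperNF_holds`, Euler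
cells through `[π]` (`IntegerSums.nf_reflection`, `T₁ ∼ [π]`), rational cells through the point (`Thirds.nf_a_one`, after a swap for `(1, b)`).
[cite: KontsevichZagier2001, §1.2] -/
theorem normalForm_cell (T : Fin 4 → IntegralRep 1)
    (hT0 : Pinned⟦(1 : ℝ), (1 : ℚ), (1 : ℚ), T 0⟧) (hT1 : Pinned⟦(1 : ℝ), (1/2 : ℚ), (1/2 : ℚ), T 1⟧)
    (hT2 : Pinned⟦(1 : ℝ), (1/3 : ℚ), (1/2 : ℚ), T 2⟧) (hT3 : Pinned⟦(1 : ℝ), (2/3 : ℚ), (1/2 : ℚ), T 3⟧)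
    (c : ℝ) (hc : IsAlgebraic ℚ c) (a b : ℚ) (hcell : Cell⟦a, b⟧) (r : IntegralRep 1) (hr : Pinned⟦c, a, b, r⟧) :
    ∃ (i : Fin 4) (q : ℝ) (hk : IsAlgebraic ℚ (c * q)), q ≠ 0 ∧ Equivalent r ((T i).constMul (c * q) hk) := by
  obtain ⟨ha, hb, hcell⟩ := hcell
  rcases hcell with ⟨hqa, hqb⟩ | ⟨ha1, rfl⟩ | rfl | rfl
  · -- sixth cells
    obtain ⟨i, q, hk, hq, e⟩ := rung6_normalForm upperNF_holds hc hqa hqb hr T hT0 hT1 hT2 hT3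
    exact ⟨i, q, hk, hq.ne', e⟩
  · -- the Euler cell `(a, 1 − a)` onto `(c / sin πa)·T₁`
    have hs : IsAlgebraic ℚ (Real.sin (Real.pi * a)) := isAlgebraic_sin_pi_mul_rat ha
    have hs0 : Real.sin (Real.pi * a) ≠ 0 := (sin_pi_mul_pos ha ha1).ne'
    have hk : IsAlgebraic ℚ (c * (Real.sin (Real.pi * a))⁻¹) := hc.mul hs.inv
    obtain ⟨e, -⟩ := nf_reflection ha ha1 hr hk
    have e₁ : Equivalent ((T 1).constMul (c * (Real.sin (Real.pi * a))⁻¹) hk)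
        (piRep.constMul (c * (Real.sin (Real.pi * a))⁻¹) hk) :=
      (T₁_equivalent_piRep hT1).constMul _ hk
    exact ⟨1, (Real.sin (Real.pi * a))⁻¹, hk, inv_ne_zero hs0, e.trans e₁.symm⟩
  · -- the rational cell `(1, b)`: swap, then the point
    obtain ⟨ρ, hρ⟩ := exists_pinned c hc hb (by norm_num : (0:ℚ) < 1)
    have e : Equivalent r ρ := pinned_swap hc (by norm_num) hb hr hρ
    obtain ⟨q, hk, hq, e', -⟩ := nf_a_one hc hb hρ hT0
    exact ⟨0, q, hk, hq.ne', e.trans e'⟩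
  · -- the rational cell `(a, 1)`: the point
    obtain ⟨q, hk, hq, e, -⟩ := nf_a_one hc ha hr hT0
    exact ⟨0, q, hk, hq.ne', e⟩

/-- The values `κ_i v_i` of the canonical cells are pairwise NOT algebraic multiples of one another (Chudnovsky through `Thirds.v_sep`, the `κ_i`
being non-zero algebraic). [cite: Chudnovsky1984, Ch. 7 §2 Cor. 2.3] -/
theorem kv_sep (i j : Fin 4) (hij : i ≠ j) (k : ℝ) (hk : IsAlgebraic ℚ k) : κ i * v i ≠ k * (κ j * v j) := by
  intro h
  set A : ℝ := κ i with hA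
  set B : ℝ := κ j with hB
  set x : ℝ := v i with hx
  set y : ℝ := v j with hy
  have hA0 : A ≠ 0 := (rung6_kappa_pos i).ne'
  refine v_sep i j hij (k * B * A⁻¹) ((hk.mul (rung6_kappa_alg j)).mul (rung6_kappa_alg i).inv) ?_
  show x = k * B * A⁻¹ * y
  calc x = A⁻¹ * (A * x) := by rw [← mul_assoc, inv_mul_cancel₀ hA0, one_mul]
    _ = A⁻¹ * (k * (B * y)) := by rw [h]
    _ = k * B * A⁻¹ * y := by ring

/-- **`BetaLinearSector` ON THE MAXIMAL `(π, Γ(1/3))`-SECTOR, UNCONDITIONALLY** (registered anchor `betaLinearSector_sixthsMax`): Conjecture 1 of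
Kontsevich–Zagier for every pair of Beta integrals `[∫₀¹ t^{a-1}(1-t)^{b-1}dt]`, `[∫₀¹ c·t^{a'-1}(1-t)^{b'-1}dt]` (positive rational exponents, `c` real
algebraic, equal values) such that EACH pair of exponents is sixth-integral, or of integral sum, or has an integral exponent.
[cite: KontsevichZagier2001, §1.2] [cite: Chudnovsky1984, Ch. 7 §2 Cor. 2.3] -/
theorem betaLinearSector_sixthsMax : ∀ (a b a' b' : ℚ) (c : ℝ), 0 < a → 0 < b → 0 < a' → 0 < b' → IsAlgebraic ℚ c →
    (((∃ m : ℤ, a = m / 6) ∧ (∃ m : ℤ, b = m / 6)) ∨ (∃ m : ℤ, a + b = m) ∨ (∃ m : ℤ, a = m) ∨ (∃ m : ℤ, b = m)) →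
    (((∃ m : ℤ, a' = m / 6) ∧ (∃ m : ℤ, b' = m / 6)) ∨ (∃ m : ℤ, a' + b' = m) ∨ (∃ m : ℤ, a' = m) ∨ (∃ m : ℤ, b' = m)) →
    ∀ (r r' : KZ.IntegralRep 1), r.domain = {x | x 0 ∈ Set.Ioo (0:ℝ) 1} →
    Set.EqOn r.integrand (fun x => (x 0) ^ ((a:ℝ) - 1) * (1 - x 0) ^ ((b:ℝ) - 1)) r.domain →
    r'.domain = {x | x 0 ∈ Set.Ioo (0:ℝ) 1} →
    Set.EqOn r'.integrand (fun x => c * (x 0) ^ ((a':ℝ) - 1) * (1 - x 0) ^ ((b':ℝ) - 1)) r'.domain →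
    r.value = r'.value → KZ.Equivalent r r' := by
  intro a b a' b' c ha hb ha' hb' hc hm hm' r r' hd hi hd' hi' hv
  -- the four canonical cells of the level-6 rung, all with constant `1`
  obtain ⟨T0, hT0⟩ := exists_pinned (1 : ℝ) isAlgebraic_one (by norm_num : (0:ℚ) < 1) (by norm_num : (0:ℚ) < 1)
  obtain ⟨T1, hT1⟩ := exists_pinned (1 : ℝ) isAlgebraic_one (by norm_num : (0:ℚ) < 1/2) (by norm_num : (0:ℚ) < 1/2)
  obtain ⟨T2, hT2⟩ := exists_pinned (1 : ℝ) isAlgebraic_one (by norm_num : (0:ℚ) < 1/3) (by norm_num : (0:ℚ) < 1/2)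
  obtain ⟨T3, hT3⟩ := exists_pinned (1 : ℝ) isAlgebraic_one (by norm_num : (0:ℚ) < 2/3) (by norm_num : (0:ℚ) < 1/2)
  have hTv : ∀ i : Fin 4, (![T0, T1, T2, T3] i).value = (fun i => κ i * v i) i := by
    intro i
    fin_cases i
    · exact rung6_value_T0 hT0
    · exact rung6_value_T1 hT1
    · exact rung6_value_T2 hT2
    · exact rung6_value_T3 hT3
  have hw : ∀ i : Fin 4, 0 < (fun i => κ i * v i) i := fun i => mul_pos (rung6_kappa_pos i) (v_pos i)
  -- base pairs of the sector are base cells: sixth, Euler, or rational (an integer in `(0,1]` is `1`)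
  have cell_of_sec : ∀ a b : ℚ, 0 < a → a ≤ 1 → 0 < b → b ≤ 1 → Sec⟦a, b⟧ → Cell⟦a, b⟧ := by
    intro a b ha ha1 hb hb1 h
    refine ⟨ha, hb, ?_⟩
    have hint : ∀ {q : ℚ} {m : ℤ}, 0 < q → q ≤ 1 → q = m → q = 1 := by
      intro q m hq hq1 hqm
      have h1 : (0 : ℚ) < m := by rw [← hqm]; exact hq
      have h2 : (m : ℚ) ≤ 1 := by rw [← hqm]; exact hq1
      have h1' : 0 < m := by exact_mod_cast h1
      have h2' : m ≤ 1 := by exact_mod_cast h2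
      have : m = 1 := le_antisymm h2' h1'
      rw [hqm, this, Int.cast_one]
    rcases h with ⟨hma, hmb⟩ | hm | ⟨m, hm⟩ | ⟨m, hm⟩
    · exact Or.inl ⟨sixth_cases ha ha1 hma, sixth_cases hb hb1 hmb⟩
    · rcases base_cases ha ha1 hb hb1 hm with h | ⟨rfl, rfl⟩
      · exact Or.inr (Or.inl h)
      · exact Or.inr (Or.inr (Or.inl rfl))
    · exact Or.inr (Or.inr (Or.inl (hint ha ha1 hm)))
    · exact Or.inr (Or.inr (Or.inr (hint hb hb1 hm)))
  have hS₁ : ∀ a b : ℚ, Sec⟦a, b⟧ → Sec⟦a, (b - 1)⟧ := fun a b h => by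
    simpa using secN_sub_right 6 a b (by simpa using h)
  have hS₂ : ∀ a b : ℚ, Sec⟦a, b⟧ → Sec⟦b, (a - 1)⟧ := fun a b h => by
    simpa using secN_swap_sub 6 a b (by simpa using h)
  refine betaLinearSector_of_oracle (fun a b => Sec⟦a, b⟧) hS₁ hS₂ (fun a b => Cell⟦a, b⟧) cell_of_sec
    (fun a b h => ⟨h.1, h.2.1⟩) ![T0, T1, T2, T3] (fun i => κ i * v i) hTv hw (fun i j hij k hk => kv_sep i j hij k hk)
    (normalForm_cell ![T0, T1, T2, T3] hT0 hT1 hT2 hT3)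
    a b a' b' ha hb ha' hb' hm hm' 1 c r r' isAlgebraic_one hc ⟨hd, fun x hx => ?_⟩ ⟨hd', hi'⟩ hv
  simp only [hi hx, one_mul]

end Summit.KontsevichZagierPeriods.FermatIsogeny.BetaLinearSector.SixthsMax

end
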